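import Summits.CriticalPhenomena.PercolationContinuityZ3.Theorems.FK.LocalPatternCLT
import Summits.CriticalPhenomena.PercolationContinuityZ3.Theorems.FK.EdgeCountCLTVariance
import Summits.CriticalPhenomena.PercolationContinuityZ3.Theorems.FK.GibbsConditionalEnergy
import HarnessLib

/-!
# NON-DEGENERACY OF NEWMAN'S CLT FOR INCREASING LOCAL PATTERNS OF `φ^b_{p,q}` BELOW `p_c(q)`:
# `σ²_E = Σ_z Cov_{φ^b}(1_E, 1_E ∘ T_z) ≥ φ^b(E)(1 − φ^b(E)) > 0` FOR EVERY NON-TRIVIAL INCREASING LOCAL EVENT `E`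

Claimed R42 (8)(c) in the cell INBOX at 2026-08-28T13:56:48Z by fkp-10a gen 354 (NEW CLAIM #2 of the gen), addressed to coordinator fk-4 g274 (seated 13:10Z 2026-08-28 by l.8389; R151 l.8390: row FO-10a-g354 [g274, R151] = package g354-newmanclt, its (κ) SPENT by l.8399 — hence a new ruling); lineage row FO-10a-g354x (self-suggested), package g354-cltextras, label PV-D.
Helper file of the `fk-continuity` build cell (bschramm lane; `--supports stmt-CriticalPhenomena-4575`); builds on
p205010 (kernel theorem, internal audit signed; external expert review pending). No definitions, no named facts, no
sorries; standard axioms. UNCONDITIONAL.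

`LocalPatternCLT.lean` proves `(N_n(E) − E N_n(E))/√|Λ_n| ⇒ N(0, σ²_E)` for the number `N_n(E)` of occurrences in
`Λ_n` of an increasing local pattern `E` (determined by `F ⊆ E(Λ_k)`) under `φ^b_{p,q}`, `0 ≤ p < p_c(q)`, with
`σ²_E = Σ_{z∈ℤ^d} Cov_{φ^b}(1_E, 1_E ∘ T_z)`. This file shows the limit law is a GENUINE Gaussian: by FKG every term of
the series is `≥ 0`, the `z = 0` term is `Var(1_E) = φ^b(E)(1 − φ^b(E))`, and by FINITE ENERGY (Grimmett Thm. (4.17)(b):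
every pattern cylinder on finitely many edges is charged, tree `FKGibbs.localCylinder_pos`) `0 < φ^b(E) < 1` as soon as
`∅ ≠ E ≠ univ` and `0 < p < 1`:

* `FKGibbs.real_pos_of_determinedBy`, `FKGibbs.real_lt_one_of_determinedBy` — `0 < P(E) < 1` for every FK-Gibbs
  measure `P` (`0 < p < 1`, `q ≥ 1`) and every event `E` determined by a finite set of EDGES with `∅ ≠ E ≠ univ`;
* `variance_le_tsum_patternCov` — `Var_{φ^b}(1_E) ≤ σ²_E` for increasing `E` whenever the series is summable;
* `tsum_patternCov_ge` — `σ²_E ≥ φ^b(E)(1 − φ^b(E))`;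
* `tsum_patternCov_pos` — **`σ²_E > 0`** for `d ≥ 2`, `q ≥ 1`, `0 < p < p_c(q)`, both `b`, every increasing `E`
  determined by `F ⊆ E(Λ_k)` with `∅ ≠ E ≠ univ`.

## References

* C. M. Newman, *Normal fluctuations and the FKG inequalities*, Comm. Math. Phys. 74 (1980) 119–128, Thm. 2, (10), (13).
  [Newman1980]
* G. Grimmett, *The Random-Cluster Model*, Springer 2006, Thm. (4.17)(b), Thm. (4.19)(b), eq. (3.4). [Grimmett2006]
-/

noncomputable section

namespace Summit.CriticalPhenomena.PercolationContinuityZ3.Theorems.FK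

open MeasureTheory ProbabilityTheory Finset Filter Topology
open Literature.Probability.Percolation Literature.Probability.LatticeModels Literature.Barriers.CriticalPhenomena

variable {d : ℕ} {p q : ℝ}

namespace FKGibbs

variable {P : Measure (BondConfig (Site d))}

/-- **A nonempty local event is charged**: for an `FKGibbs` measure `P` (`0 < p < 1`, `q ≥ 1`) and an event `E`
determined by a finite set `F` of edges of `ℤ^d`, `E ≠ ∅ ⇒ P(E) > 0` — `E` contains the pattern cylinder on `F` of
any of its configurations, which is charged by finite energy. [cite: Grimmett2006, Thm. (4.17)(b) (p. 75); eq. (3.4)] -/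
theorem real_pos_of_determinedBy (hG : FKGibbs d p q P) (hp : p ∈ Set.Ioo (0 : ℝ) 1) (hq : 1 ≤ q)
    {F : Finset (Sym2 (Site d))} (hFE : (↑F : Set (Sym2 (Site d))) ⊆ (zdGraph d).edgeSet)
    {E : Set (BondConfig (Site d))} (hE : DeterminedBy E ↑F) (hne : E.Nonempty) : 0 < P.real E := by
  classical
  haveI := hG.isProbabilityMeasure
  obtain ⟨ω, hω⟩ := hne
  have hTF : F.filter (fun e => e ∈ ω) ⊆ F := Finset.filter_subset _ _
  have hsub : localCylinder (↑F : Set (Sym2 (Site d))) ↑(F.filter fun e => e ∈ ω) ⊆ E := by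
    intro ω' hω'
    have hagree : ω' ∩ ↑F = ω ∩ ↑F := by
      ext e
      simp only [Set.mem_inter_iff, Finset.mem_coe]
      constructor
      · rintro ⟨h1, h2⟩
        have h3 := (hω' e (Finset.mem_coe.2 h2)).1 h1
        rw [Finset.mem_coe, Finset.mem_filter] at h3
        exact ⟨h3.2, h2⟩
      · rintro ⟨h1, h2⟩
        exact ⟨(hω' e (Finset.mem_coe.2 h2)).2 (by rw [Finset.mem_coe, Finset.mem_filter]; exact ⟨h2, h1⟩), h2⟩
    exact ((determinedBy_iff E ↑F).1 hE ω' ω hagree).2 hω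
  exact (hG.localCylinder_pos hp hq hFE hTF).trans_le (measureReal_mono hsub)

/-- **A non-full local event is not almost sure**: under the same hypotheses `E ≠ univ ⇒ P(E) < 1` (apply the
previous bound to the complement, which is determined by the same edges). [cite: Grimmett2006, Thm. (4.17)(b) (p. 75)] -/
theorem real_lt_one_of_determinedBy (hG : FKGibbs d p q P) (hp : p ∈ Set.Ioo (0 : ℝ) 1) (hq : 1 ≤ q)
    {F : Finset (Sym2 (Site d))} (hFE : (↑F : Set (Sym2 (Site d))) ⊆ (zdGraph d).edgeSet)
    {E : Set (BondConfig (Site d))} (hE : DeterminedBy E ↑F) (hnu : E ≠ Set.univ) : P.real E < 1 := by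
  haveI := hG.isProbabilityMeasure
  have hEm : MeasurableSet E := hE.measurableSet_of_finset
  have hEc : DeterminedBy Eᶜ ↑F := by
    rw [determinedBy_iff] at hE ⊢
    intro ω ω' h
    rw [Set.mem_compl_iff, Set.mem_compl_iff, hE ω ω' h]
  have hc := hG.real_pos_of_determinedBy hp hq hFE hEc (Set.nonempty_compl.2 hnu)
  rw [probReal_compl_eq_one_sub hEm] at hc
  linarith

end FKGibbs

namespace NewmanCLT

/-! ### `σ²_E ≥ Var(1_E)` -/

/-- **`Var_{φ^b}(1_E) ≤ Σ_z Cov_{φ^b}(1_E, 1_E ∘ T_z)`** for an increasing measurable `E` whenever the series is summable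
(`0 ≤ p ≤ 1`, `q ≥ 1`): every term is `≥ 0` by FKG and the `z = 0` term is the variance (`T_0 = id`).
[cite: Newman1980, (10) and (13); Grimmett2006, Thm. (4.17)(b), Thm. (4.19)(b)] -/
theorem variance_le_tsum_patternCov (b : Bool) (hp : p ∈ Set.Icc (0 : ℝ) 1) (hq : 1 ≤ q)
    {E : Set (BondConfig (Site d))} (hEm : MeasurableSet E) (hEup : IsUpperSet E)
    (hs : Summable fun z : Site d => cov[E.indicator (1 : BondConfig (Site d) → ℝ),
      fun ω => E.indicator (1 : BondConfig (Site d) → ℝ) (BondConfig.relabel (sym2Equiv (Site.shift (-z))) ω);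
        rcLimit d b p q]) :
    Var[E.indicator (1 : BondConfig (Site d) → ℝ); rcLimit d b p q] ≤
      ∑' z : Site d, cov[E.indicator (1 : BondConfig (Site d) → ℝ),
        fun ω => E.indicator (1 : BondConfig (Site d) → ℝ) (BondConfig.relabel (sym2Equiv (Site.shift (-z))) ω);
          rcLimit d b p q] := by
  haveI := isProbabilityMeasure_rcLimit (d := d) b p q
  have hμ : IsPositivelyAssociated (rcLimit d b p q) := isPositivelyAssociated_rcLimit b hp hq
  -- `T_0 = id`
  have hT0 : ∀ ω : BondConfig (Site d), BondConfig.relabel (sym2Equiv (Site.shift (-(0 : Site d)))) ω = ω := by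
    intro ω
    rw [neg_zero]
    ext z
    rw [BondConfig.mem_relabel_iff, sym2Equiv_symm, sym2Equiv_apply]
    have h : ((Site.shift (0 : Site d)).symm : Site d → Site d) = id :=
      funext fun x => by rw [Site.shift_symm_apply, sub_zero]; rfl
    rw [h, Sym2.map_id, id]
  have hmono0 : Monotone (E.indicator (1 : BondConfig (Site d) → ℝ)) := by
    have h := monotone_patternAt hEup (0 : Site d)
    simp only [hT0] at h
    exact h
  have h0 := hs.le_tsum (0 : Site d) fun z _ => covariance_nonneg_of_monotone hμ hmono0 (monotone_patternAt hEup z)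
    (measurable_const.indicator hEm) (measurable_patternAt hEm z) ⟨1, abs_indicator_one_le_one E⟩
    ⟨1, fun ω => abs_indicator_one_le_one E _⟩
  refine le_trans (le_of_eq ?_) h0
  simp only [hT0]
  exact (covariance_self (measurable_const.indicator hEm).aemeasurable).symm

/-- **`σ²_E ≥ φ^b(E)(1 − φ^b(E))`**: the CLT variance of an increasing local pattern dominates the one-site variance.
[cite: Newman1980, (13); Grimmett2006, Thm. (4.17)(b)] -/
theorem tsum_patternCov_ge (b : Bool) (hp : p ∈ Set.Icc (0 : ℝ) 1) (hq : 1 ≤ q)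
    {E : Set (BondConfig (Site d))} (hEm : MeasurableSet E) (hEup : IsUpperSet E)
    (hs : Summable fun z : Site d => cov[E.indicator (1 : BondConfig (Site d) → ℝ),
      fun ω => E.indicator (1 : BondConfig (Site d) → ℝ) (BondConfig.relabel (sym2Equiv (Site.shift (-z))) ω);
        rcLimit d b p q]) :
    (rcLimit d b p q).real E * (1 - (rcLimit d b p q).real E) ≤
      ∑' z : Site d, cov[E.indicator (1 : BondConfig (Site d) → ℝ),
        fun ω => E.indicator (1 : BondConfig (Site d) → ℝ) (BondConfig.relabel (sym2Equiv (Site.shift (-z))) ω);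
          rcLimit d b p q] := by
  haveI := isProbabilityMeasure_rcLimit (d := d) b p q
  rw [← variance_indicator_one_eq _ hEm]
  exact variance_le_tsum_patternCov b hp hq hEm hEup hs

/-- **NEWMAN'S CLT FOR INCREASING LOCAL PATTERNS BELOW `p_c(q)` IS NON-DEGENERATE**: for `d ≥ 2`, `q ≥ 1`,
`0 < p < p_c(q)`, both `b`, and every increasing event `E` determined by `F ⊆ E(Λ_k)` with `∅ ≠ E ≠ univ`, the
limiting variance `σ²_E = Σ_z Cov_{φ^b}(1_E, 1_E ∘ T_z)` of `tendstoInDistribution_patternCount` satisfies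
`σ²_E ≥ φ^b(E)(1 − φ^b(E)) > 0`. [cite: Newman1980, Thm. 2 and (13); Grimmett2006, Thm. (4.17)(b), eq. (3.4)] -/
theorem tsum_patternCov_pos (hd : 2 ≤ d) (hq : 1 ≤ q) (hp0 : 0 < p) (hpc : p < rcCriticalProb d q) {k : ℕ}
    {F : Finset (Sym2 (Site d))} (hF : F ⊆ edgesIn (zdGraph d) (box d k)) {E : Set (BondConfig (Site d))}
    (hE : DeterminedBy E ↑F) (hEup : IsUpperSet E) (hne : E.Nonempty) (hnu : E ≠ Set.univ) (b : Bool) :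
    0 < ∑' z : Site d, cov[E.indicator (1 : BondConfig (Site d) → ℝ),
        fun ω => E.indicator (1 : BondConfig (Site d) → ℝ) (BondConfig.relabel (sym2Equiv (Site.shift (-z))) ω);
          rcLimit d b p q] := by
  have hp1 : p < 1 := hpc.trans (rcCriticalProb_lt_one hd hq)
  have hp : p ∈ Set.Icc (0 : ℝ) 1 := ⟨hp0.le, hp1.le⟩
  haveI := isProbabilityMeasure_rcLimit (d := d) b p q
  have hG : FKGibbs d p q (rcLimit d b p q) := (isBoxLimit_rcLimit b hp hq).fkGibbs hp hq
  have hFE : (↑F : Set (Sym2 (Site d))) ⊆ (zdGraph d).edgeSet := fun e he => (mem_edgesIn_iff.1 (hF he)).1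
  have hEm : MeasurableSet E := hE.measurableSet_of_finset
  have hpos := hG.real_pos_of_determinedBy ⟨hp0, hp1⟩ hq hFE hE hne
  have hlt := hG.real_lt_one_of_determinedBy ⟨hp0, hp1⟩ hq hFE hE hnu
  have hvar : 0 < (rcLimit d b p q).real E * (1 - (rcLimit d b p q).real E) := mul_pos hpos (by linarith)
  exact hvar.trans_le (tsum_patternCov_ge b hp hq hEm hEup (summable_patternCov hd hq hp0.le hpc hF hE b))

end NewmanCLT

end Summit.CriticalPhenomena.PercolationContinuityZ3.Theorems.FK
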